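import Literature.Geometry.Kaehler.ComplexTorusLefschetzSL2ActionStrings
import Literature.Geometry.Kaehler.GradedFormsIsotypicTensorDecomposition
import Literature.Algebra.Lie.LefschetzModuleCharacter
import Mathlib.Algebra.BigOperators.Ring.Finset
import HarnessLib

/-!
# The CHARACTER of Beauville's `SL₂`-action on the cohomology of a polarised complex torus:
# `tr ρ(diag(t, t⁻¹)) = Σ_{k=0}^{2g} C(2g, k) t^{k−g} = t^{−g}(1 + t)^{2g}`, `tr ρ(−1) = 0`, `tr ρ(unipotent) = 4^g`,
# and the weight ∕ lowest-weight multiplicities `dim M_{k−g} = C(2g, k)`, `dim P_{−n} = dim P^{g−n}(η)`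

Layer `Literature/Geometry/Kaehler`, namespace `Literature.Geometry.Kaehler.ComplexTorus`; lane `lit-hodgefound` (Track 2 foundations
library), prover seat `lit-hodgefound-p09` (generation 53, row g53-#2). THEOREMS ONLY (no definition, no named fact, no instance, no
notation; D-0026 net debt `0`). Sequel of rows g51-#9 `ComplexTorusLefschetzSL2Action` (`ρ = (hasLefschetzProperty_lefschetzG hη).sl2Rep
isZGrading_countingG : SL(2, ℂ) →* End_ℂ(H•(X; ℂ))`, `ρ(diag(t, t⁻¹)) = tʰ = t^{k−g}` on `Hᵏ`), g52-#7 `ComplexTorusLefschetzSL2ActionStrings`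
(`mem_primitiveSpace_iff_exists_of`: the abstract `P_{−n}` is `P^{g−n}(η)` placed in degree `g − n`), of p34's abstract row g39-#6
`Algebra/Lie/LefschetzModuleCharacter` (THE CHARACTER of a Lefschetz module: `IsZGrading.trace_torus` `tr tʰ = Σ_m dim M_m · t^m`,
`trace_sl2Rep_of_coe_eq_upper/lower` `= dim M`, `trace_sl2Rep_neg_one`), and of `GradedFormsIsotypicTensorDecomposition` (`finrank_gForm`:
`dim_ℂ H•(X; ℂ) = 2^{2g}`), `ComplexTorusLefschetzDecomposition` (`finrank_primitiveForms_add_choose`: `dim Pᵏ + C(2g, k−2) = C(2g, k)`),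
`Analysis/Complex/PQDimension` (`finrank_alt_real_complex`: `dim_ℂ Alt^k_ℝ(E; ℂ) = C(2g, k)`).

SETTING. `E` a complex normed space of dimension `g ≥ 1` (`V = H₁(X; ℝ)` of the complex torus `X = V/Λ`), `H•(X; ℂ) = GForm E ℂ = Π_k Alt^k_ℝ(E; ℂ)`
with the grading `h = countingG E` (`k − g` on `Hᵏ`: `M_{k−g} = Hᵏ`, `degreeSpace (countingG E) (k − g)`), `η` a non-degenerate real `2`-form
(`hη`), `L_η = lefschetzG η`, `P_{−n} = primitiveSpace (countingG E) (lefschetzG η) n` the abstract lowest-weight spaces, `Pᵏ(η) = primitiveForms η k`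
Lange's primitive forms.

## What is proved

* §1 THE WEIGHT SPACES AS FORMS: `degreeSpace_countingG_eq_range_single` (`M_{k−g} = Hᵏ` placed by `single k = GForm.of k`),
  **`finrank_degreeSpace_countingG`: `dim_ℂ M_{k−g} = C(2g, k)`** (all `k`; `= 0` beyond `2g`), `finrank_degreeSpace_countingG_of_lt`;
  `primitiveSpace_countingG_eq_map` and **`finrank_primitiveSpace_countingG`: `dim P_{−n} = dim P^{g−n}(η)`** (`n ≤ g`), `= 0` for `n > g`
  (`finrank_primitiveSpace_countingG_of_lt`), closed form **`finrank_primitiveSpace_countingG_add_choose`: `dim P_{−n} + C(2g, g−n−2) = C(2g, g−n)`**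
  (`n + 2 ≤ g`) and `finrank_primitiveSpace_countingG_of_le_one` (`n = g, g − 1`: `1`, `2g`) — the MULTIPLICITY of the irreducible `V_n` (the string of
  length `n + 1`) in `H•(X; ℂ)` (Beauville §5 Proposition: "`CH(A)` is a direct sum of subrepresentations of this type").
* §2 THE CHARACTER: **`trace_torus_countingG`: `tr tʰ = Σ_{k=0}^{2g} C(2g, k) · t^{k−g}`** (any `t`), **`trace_sl2Rep_diagonal`:
  `tr ρ(diag(t, t⁻¹)) = Σ_{k=0}^{2g} C(2g, k) t^{k−g}`**, **`trace_sl2Rep_diagonal_eq`: `= t^{−g} (1 + t)^{2g}`** (the Poincaré polynomial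
  `Σ_k b_k(X) tᵏ = (1 + t)^{2g}` shifted by Beauville's `t^{−g}`: "`τ(t) = t^{−g} Σᵢ tⁱ πᵢ`"), `trace_sl2Rep_diagonal_ofReal`
  (Beauville's integers `n`: `tr ρ(diag(n, n⁻¹)) = n^{−g}(1 + n)^{2g}`); **`trace_sl2Rep_neg_one_eq_zero`: `tr ρ(−1) = 0`** and
  `trace_weylOperator_mul_weylOperator_eq_zero` (`tr w² = 0`: `Σ_k (−1)^k C(2g, k) = 0`, `g ≥ 1`); `trace_sl2Rep_upper` ∕ `trace_sl2Rep_lower`: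
  `tr ρ(1 a ; 0 1) = tr ρ(1 0 ; a 1) = 4^g = dim H•(X; ℂ)`; `trace_sl2Rep_one`.
* §3 THE LEFSCHETZ DECOMPOSITION IN DIMENSIONS on the torus carrier: **`choose_eq_sum_finrank_primitiveForms`:
  `C(2g, k) = Σ_{r ≤ k/2} dim P^{k−2r}(η)`** for `k ≤ g` (Beauville §5 Corollary "`CH^p_s(A) = ⊕_{q≤p} θ^{p−q} P^q_s`" ∕ Lange (1) in dimensions;
  the tree's Hodge-number refinement is `IsNSForm.choose_mul_choose_eq_sum_primitiveHodgeNumber`).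

## Sources, VERBATIM

* A. Beauville, *The action of SL₂ on abelian varieties*, J. Ramanujan Math. Soc. 25 (2010) [Beauville2010SL2] (held text
  `paper:arxiv-0805.1541`), §3 Theorem, proof (p0004): "We define `τ : 𝔾_m → Corr(A)` by `τ(t) = t^{−g} Σᵢ tⁱ πᵢ`, where `(πᵢ)` is the family
  of orthogonal idempotents considered in (2.b)"; §4 Theorem (p0005): "`(n 0 ; 0 n⁻¹)·z = n^{−g} n^*z`, […] `(1 a ; 0 1)·z = e^{aθ} z`,
  `(1 0 ; a 1)·z = d⁻¹ a^g e^{θ/a} ∗ z` […] In particular, `H` is diagonalizable and `X, Y` are nilpotent"; §5 (p0006): "**Proposition** If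
  `z ∈ CH^p_s(A)` is primitive, […] `(z, θz, …, θ^{g+s−2p} z)` is a basis of an irreducible subrepresentation of `CH(A)`. The vector space `CH(A)`
  is a direct sum of subrepresentations of this type. **Corollary** Let `P^p_s ⊂ CH^p_s(A)` be the subspace of primitive elements. Then
  `CH^p_s(A) = ⊕_{q ≤ p} θ^{p−q} P^q_s`."
* W. Fulton, J. Harris, *Representation Theory. A First Course*, GTM 129 [FultonHarris1991], §23.2 (23.23) "`Char[V] = Σ dim(V_λ) e(λ)`",
  (23.40) "the trace of `exp(X)` on `V` is `Σ m_α e^{α(X)}`"; §11.1 (11.7) (the irreducible `V(n)` is determined by its weights).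
* H. Lange, *Abelian Varieties over the Complex Numbers* (2023) [Lange2023AbelianVarietiesComplex], §1.1.3 Cor. 1.1.19 and §1.1 Exercise (8)
  (`H^n(X, ℤ)` free of rank `C(2g, n)`), §7.3.2 (1), (3) (p. 338: `H^k = ⊕ L^r P^{k−2r}`, `dim Pᵏ = C(2g, k) − C(2g, k−2)`).
* E. Looijenga, V. A. Lunts, *A Lie algebra attached to a projective variety*, Invent. Math. 129 (1997) [LooijengaLunts1997], §1 (1.15)
  ("`dim M_{−n} < dim M_{−n+2} < ⋯`", the two-term decomposition).

## Scope

Torus-forms carrier only (`M_m = H^{m+g}(X; ℂ)`); the Chow-theoretic `s`-grading of Beauville is not modelled. The total dimension `4^g`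
is the tree's `finrank_gForm`, not restated; the character as a sum of irreducible characters is not stated here.
-/

noncomputable section

-- `Module ℂ` / `SMulZeroClass ℂ` synthesis on `E [⋀^Fin k]→L[ℝ] ℂ` (as in `ComplexTorusLefschetzDecomposition`)
set_option maxSynthPendingDepth 3

namespace Literature.Geometry.Kaehler

namespace ComplexTorus

open Module Function Finset
open scoped MatrixGroups
open Literature.LinearAlgebra.Alternating Literature.Algebra.Lie

universe uE

variable {E : Type uE} [NormedAddCommGroup E] [NormedSpace ℂ E] [FiniteDimensional ℂ E] [Nontrivial E] {η : E [⋀^Fin 2]→L[ℝ] ℝ}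

/-! ## §1 The weight spaces and the lowest-weight spaces of `(H•(X; ℂ), h, L_η)` as forms -/

section Weights

omit [FiniteDimensional ℂ E] [Nontrivial E] in
/-- **`M_{k−g} = Hᵏ(X; ℂ)` placed in degree `k`**: the weight-`(k − g)` space of `h` is the range of `single k = GForm.of k`
(`mem_degreeSpace_countingG_iff`: its elements are the homogeneous graded forms of degree `k`). [cite: LooijengaLunts1997, §1 (1.1) p. 3]
[cite: HuybrechtsCG2005, §1.2 Def. 1.2.25] -/
theorem degreeSpace_countingG_eq_range_single (k : ℕ) :
    degreeSpace (countingG E) ((k : ℤ) - (finrank ℂ E : ℤ)) =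
      LinearMap.range (LinearMap.single ℂ (fun m : ℕ ↦ E [⋀^Fin m]→L[ℝ] ℂ) k) := by
  ext w
  rw [mem_degreeSpace_countingG_iff, LinearMap.mem_range]
  refine ⟨fun hw ↦ ⟨w k, hw.eq_of.symm⟩, ?_⟩
  rintro ⟨x, rfl⟩
  exact GForm.IsHomog.of k x

omit [Nontrivial E] in
/-- **`dim_ℂ M_{k−g} = dim_ℂ Hᵏ(X; ℂ) = C(2g, k)`** for every `k` (`b_k(X) = C(2g, k)`; both sides vanish for `k > 2g`).
[cite: Lange2023AbelianVarietiesComplex, §1.1.3 Cor. 1.1.19 and §1.1 Exercise (8)] [cite: FultonHarris1991, §23.2 (23.23)] -/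
theorem finrank_degreeSpace_countingG (k : ℕ) :
    finrank ℂ ↥(degreeSpace (countingG E) ((k : ℤ) - (finrank ℂ E : ℤ))) = (2 * finrank ℂ E).choose k := by
  rcases le_or_gt k (2 * finrank ℂ E) with hk | hk
  · haveI := finiteDimensional_alt_of_le (E := E) hk
    rw [degreeSpace_countingG_eq_range_single, ← Submodule.map_top,
      ← (Submodule.equivMapOfInjective _ (fun a b hab ↦ GForm.of_injective (V := E) (F := ℂ) k hab) ⊤).finrank_eq, finrank_top,
      Literature.Analysis.Complex.finrank_alt_real_complex]
  · rw [degreeSpace_countingG_eq_bot_of_gt (by omega), finrank_bot, Nat.choose_eq_zero_of_lt hk]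

omit [FiniteDimensional ℂ E] [Nontrivial E] in
/-- `dim M_m = 0` for `m < −g`. [cite: HuybrechtsCG2005, §1.2 Def. 1.2.25] -/
theorem finrank_degreeSpace_countingG_of_lt {m : ℤ} (hm : m < -(finrank ℂ E : ℤ)) :
    finrank ℂ ↥(degreeSpace (countingG E) m) = 0 := by
  rw [degreeSpace_countingG_eq_bot_of_lt hm, finrank_bot]

/-- **`P_{−n} = P^{g−n}(η)` placed in degree `g − n`** (`n ≤ g`): the abstract lowest-weight space of weight `−n` is the image of Lange's
primitive forms of degree `g − n` under `single (g − n)`. [cite: Beauville2010SL2, §5 Proposition (p. 6)] [cite: Lange2023AbelianVarietiesComplex, §7.3.2 (p. 338)] -/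
theorem primitiveSpace_countingG_eq_map (hη : ∀ v : E, v ≠ 0 → ∃ w : E, η ![v, w] ≠ 0) {n : ℕ} (hn : n ≤ finrank ℂ E) :
    HasLefschetzProperty.primitiveSpace (countingG E) (lefschetzG η) n =
      (primitiveForms η (finrank ℂ E - n)).map (LinearMap.single ℂ (fun m : ℕ ↦ E [⋀^Fin m]→L[ℝ] ℂ) (finrank ℂ E - n)) := by
  ext p
  rw [mem_primitiveSpace_iff_exists_of hη hn, Submodule.mem_map]
  constructor
  · rintro ⟨α, hα, rfl⟩
    exact ⟨α, hα, rfl⟩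
  · rintro ⟨α, hα, rfl⟩
    exact ⟨α, hα, rfl⟩

/-- **`dim P_{−n} = dim P^{g−n}(η)`** (`n ≤ g`): the multiplicity of the irreducible `V_n` — the string `(α, L_η α, …, L_ηⁿ α)` of a primitive
`α ∈ P^{g−n}(η)` — in `H•(X; ℂ)`. [cite: Beauville2010SL2, §5 Proposition (p. 6)] [cite: FultonHarris1991, §11.1 (11.7)] -/
theorem finrank_primitiveSpace_countingG (hη : ∀ v : E, v ≠ 0 → ∃ w : E, η ![v, w] ≠ 0) {n : ℕ} (hn : n ≤ finrank ℂ E) :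
    finrank ℂ ↥(HasLefschetzProperty.primitiveSpace (countingG E) (lefschetzG η) n) = finrank ℂ ↥(primitiveForms η (finrank ℂ E - n)) := by
  rw [primitiveSpace_countingG_eq_map hη hn]
  exact (Submodule.equivMapOfInjective _ (fun a b hab ↦ GForm.of_injective (V := E) (F := ℂ) (finrank ℂ E - n) hab) _).finrank_eq.symm

omit [FiniteDimensional ℂ E] [Nontrivial E] in
/-- `dim P_{−n} = 0` for `n > g` ("`g + s − 2p ≥ 0`": no lowest weights below `−g`). [cite: Beauville2010SL2, §5 Proposition (p. 6)] -/
theorem finrank_primitiveSpace_countingG_of_lt {n : ℕ} (hn : finrank ℂ E < n) :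
    finrank ℂ ↥(HasLefschetzProperty.primitiveSpace (countingG E) (lefschetzG η) n) = 0 := by
  rw [primitiveSpace_eq_bot_of_lt hn, finrank_bot]

/-- **`dim P_{−n} + C(2g, g−n−2) = C(2g, g−n)` for `n + 2 ≤ g`**: the multiplicity of `V_n` in closed form (`dim Pᵏ = C(2g, k) − C(2g, k−2)`).
[cite: Lange2023AbelianVarietiesComplex, §7.3.2 (3) (p. 338)] [cite: Beauville2010SL2, §5 Proposition (p. 6)] -/
theorem finrank_primitiveSpace_countingG_add_choose (hη : ∀ v : E, v ≠ 0 → ∃ w : E, η ![v, w] ≠ 0) {n : ℕ} (hn : n + 2 ≤ finrank ℂ E) :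
    finrank ℂ ↥(HasLefschetzProperty.primitiveSpace (countingG E) (lefschetzG η) n) + (2 * finrank ℂ E).choose (finrank ℂ E - n - 2) =
      (2 * finrank ℂ E).choose (finrank ℂ E - n) := by
  rw [finrank_primitiveSpace_countingG hη (by omega)]
  exact finrank_primitiveForms_add_choose hη (show 2 * 1 + (finrank ℂ E - n - 2) = finrank ℂ E - n by omega) (Nat.sub_le _ _)

/-- **`dim P_{−n} = C(2g, g−n)` for `g − 1 ≤ n ≤ g`** (`P⁰ = H⁰`, `P¹ = H¹`: multiplicities `1` of `V_g` and `2g` of `V_{g−1}`).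
[cite: Lange2023AbelianVarietiesComplex, §7.3.2 (p. 338)] [cite: Beauville2010SL2, §5 Proposition (p. 6)] -/
theorem finrank_primitiveSpace_countingG_of_le_one (hη : ∀ v : E, v ≠ 0 → ∃ w : E, η ![v, w] ≠ 0) {n : ℕ} (hn : n ≤ finrank ℂ E)
    (h1 : finrank ℂ E ≤ n + 1) :
    finrank ℂ ↥(HasLefschetzProperty.primitiveSpace (countingG E) (lefschetzG η) n) = (2 * finrank ℂ E).choose (finrank ℂ E - n) := by
  rw [finrank_primitiveSpace_countingG hη hn, finrank_primitiveForms_of_le_one η (by omega)]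

end Weights

/-! ## §2 The character `tr ρ(diag(t, t⁻¹)) = Σ_k C(2g, k) t^{k−g} = t^{−g}(1 + t)^{2g}` -/

section Character

omit [Nontrivial E] in
/-- The degrees carrying non-zero weight spaces lie in `{k − g | 0 ≤ k ≤ 2g}`. [cite: HuybrechtsCG2005, §1.2 Def. 1.2.25] -/
private theorem mem_image_of_degreeSpace_ne_bot₇₂ {m : ℤ} (hm : degreeSpace (countingG E) m ≠ ⊥) :
    m ∈ (range (2 * finrank ℂ E + 1)).image (fun k : ℕ ↦ (k : ℤ) - (finrank ℂ E : ℤ)) := by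
  rw [mem_image]
  have h1 : -(finrank ℂ E : ℤ) ≤ m := not_lt.1 fun h ↦ hm (degreeSpace_countingG_eq_bot_of_lt h)
  have h2 : m ≤ (finrank ℂ E : ℤ) := not_lt.1 fun h ↦ hm (degreeSpace_countingG_eq_bot_of_gt h)
  exact ⟨(m + finrank ℂ E).toNat, mem_range.2 (by omega), by omega⟩

omit [Nontrivial E] in
/-- **`tr tʰ = Σ_{k=0}^{2g} C(2g, k) · t^{k−g}`** on `H•(X; ℂ)` (`tʰ = isZGrading_countingG.torus t` acts by `t^{k−g}` on `Hᵏ`; any `t`):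
"`Char[V] = Σ dim(V_λ) e(λ)`" with `dim Hᵏ = C(2g, k)`. [cite: FultonHarris1991, §23.2 (23.23), (23.40)] [cite: Beauville2010SL2, §3 Theorem (proof, "τ(t) = t^{−g} Σᵢ tⁱ πᵢ")]
[cite: Lange2023AbelianVarietiesComplex, §1.1.3 Cor. 1.1.19] -/
theorem trace_torus_countingG (t : ℂ) :
    LinearMap.trace ℂ (GForm E ℂ) ((isZGrading_countingG (E := E)).torus t) =
      ∑ k ∈ range (2 * finrank ℂ E + 1), ((2 * finrank ℂ E).choose k : ℂ) * t ^ ((k : ℤ) - (finrank ℂ E : ℤ)) := by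
  rw [(isZGrading_countingG (E := E)).trace_torus t (fun m hm ↦ mem_image_of_degreeSpace_ne_bot₇₂ hm),
    sum_image fun a _ b _ hab ↦ by simpa using hab]
  exact sum_congr rfl fun k _ ↦ by rw [finrank_degreeSpace_countingG]

/-- **`tr ρ(diag(t, t⁻¹)) = Σ_{k=0}^{2g} C(2g, k) t^{k−g}`**: the character of Beauville's `SL₂(ℂ)`-action on `H•(X; ℂ)` on the torus
(`ρ(diag(t, t⁻¹)) = tʰ`). [cite: Beauville2010SL2, §4 Theorem ("(n 0 ; 0 n⁻¹)·z = n^{−g} n^*z")] [cite: FultonHarris1991, §23.2 (23.40)] -/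
theorem trace_sl2Rep_diagonal (hη : ∀ v : E, v ≠ 0 → ∃ w : E, η ![v, w] ≠ 0) (γ : SL(2, ℂ)) {t : ℂ}
    (hγ : (γ : Matrix (Fin 2) (Fin 2) ℂ) = !![t, 0; 0, t⁻¹]) :
    LinearMap.trace ℂ (GForm E ℂ) ((hasLefschetzProperty_lefschetzG hη).sl2Rep isZGrading_countingG γ) =
      ∑ k ∈ range (2 * finrank ℂ E + 1), ((2 * finrank ℂ E).choose k : ℂ) * t ^ ((k : ℤ) - (finrank ℂ E : ℤ)) := by
  rw [(hasLefschetzProperty_lefschetzG hη).sl2Rep_apply_of_coe_eq_diagonal isZGrading_countingG γ hγ, trace_torus_countingG]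

omit [FiniteDimensional ℂ E] [Nontrivial E] in
/-- **`Σ_{k=0}^{2g} C(2g, k) t^{k−g} = t^{−g}(1 + t)^{2g}`** for `t ≠ 0`: the binomial theorem (the Poincaré polynomial of `X` is `(1 + t)^{2g}`).
[cite: Lange2023AbelianVarietiesComplex, §1.1.3 Cor. 1.1.19 and §1.1 Exercise (8)] -/
theorem sum_choose_mul_zpow_sub (g : ℕ) {t : ℂ} (ht : t ≠ 0) :
    ∑ k ∈ range (2 * g + 1), ((2 * g).choose k : ℂ) * t ^ ((k : ℤ) - (g : ℤ)) = t ^ (-(g : ℤ)) * (1 + t) ^ (2 * g) := by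
  rw [add_comm (1 : ℂ) t, add_pow, mul_sum]
  refine sum_congr rfl fun k _ ↦ ?_
  rw [one_pow, mul_one, zpow_sub₀ ht, zpow_natCast, zpow_natCast, zpow_neg, zpow_natCast, div_eq_mul_inv]
  ring

/-- **`tr ρ(diag(t, t⁻¹)) = t^{−g}(1 + t)^{2g}`** — Beauville's `τ(t) = t^{−g} Σᵢ tⁱ πᵢ` traced: `Σᵢ bᵢ(X) tⁱ = (1 + t)^{2g}`.
[cite: Beauville2010SL2, §3 Theorem (proof, "τ(t) = t^{−g} Σᵢ tⁱ πᵢ") and §4 Theorem] [cite: Lange2023AbelianVarietiesComplex, §1.1.3 Cor. 1.1.19]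
[cite: FultonHarris1991, §23.2 (23.40)] -/
theorem trace_sl2Rep_diagonal_eq (hη : ∀ v : E, v ≠ 0 → ∃ w : E, η ![v, w] ≠ 0) (γ : SL(2, ℂ)) {t : ℂ}
    (hγ : (γ : Matrix (Fin 2) (Fin 2) ℂ) = !![t, 0; 0, t⁻¹]) :
    LinearMap.trace ℂ (GForm E ℂ) ((hasLefschetzProperty_lefschetzG hη).sl2Rep isZGrading_countingG γ) =
      t ^ (-(finrank ℂ E : ℤ)) * (1 + t) ^ (2 * finrank ℂ E) := by
  have ht : t ≠ 0 := by
    intro h0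
    have hdet := γ.2
    rw [hγ, h0, Matrix.det_fin_two_of] at hdet
    norm_num at hdet
  rw [trace_sl2Rep_diagonal hη γ hγ, sum_choose_mul_zpow_sub _ ht]

/-- **`tr ρ(diag(n, n⁻¹)) = n^{−g}(1 + n)^{2g}`** for Beauville's rational∕real `n ≠ 0` (`ρ(diag(n, n⁻¹)) = n^{−g} n_X^*`, `n_X^* = nᵏ` on `Hᵏ`).
[cite: Beauville2010SL2, §4 Theorem ("(n 0 ; 0 n⁻¹)·z = n^{−g} n^*z")] [cite: Lange2023AbelianVarietiesComplex, §6.3.1 (p. 335)] -/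
theorem trace_sl2Rep_diagonal_ofReal (hη : ∀ v : E, v ≠ 0 → ∃ w : E, η ![v, w] ≠ 0) (γ : SL(2, ℂ)) {n : ℝ}
    (hγ : (γ : Matrix (Fin 2) (Fin 2) ℂ) = !![(n : ℂ), 0; 0, (n : ℂ)⁻¹]) :
    LinearMap.trace ℂ (GForm E ℂ) ((hasLefschetzProperty_lefschetzG hη).sl2Rep isZGrading_countingG γ) =
      (n : ℂ) ^ (-(finrank ℂ E : ℤ)) * (1 + (n : ℂ)) ^ (2 * finrank ℂ E) :=
  trace_sl2Rep_diagonal_eq hη γ hγ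

omit [FiniteDimensional ℂ E] [Nontrivial E] in
/-- `Σ_{k=0}^{2g} C(2g, k) (−1)^{k−g} = 0` for `g ≥ 1` (`(1 − 1)^{2g} = 0`). [folklore] -/
private theorem sum_choose_mul_neg_one_zpow_sub₇₂ {g : ℕ} (hg : g ≠ 0) :
    ∑ k ∈ range (2 * g + 1), ((2 * g).choose k : ℂ) * (-1) ^ ((k : ℤ) - (g : ℤ)) = 0 := by
  rw [sum_choose_mul_zpow_sub g (neg_ne_zero.2 one_ne_zero), add_neg_cancel, zero_pow (by omega), mul_zero]

/-- **`tr ρ(−1) = 0`**: the centre of `SL₂(ℂ)` acts by `(−1)^{k+g}` on `Hᵏ` and `Σ_k (−1)^k C(2g, k) = 0` (`g ≥ 1`) — `H^{ev}(X)` and `H^{odd}(X)`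
have the same dimension `2^{2g−1}`. [cite: Beauville2010SL2, §3 Proposition (ii) ("h² = β(−I)") and §4 Theorem] [cite: FultonHarris1991, §23.2 (23.40)] -/
theorem trace_sl2Rep_neg_one_eq_zero (hη : ∀ v : E, v ≠ 0 → ∃ w : E, η ![v, w] ≠ 0) :
    LinearMap.trace ℂ (GForm E ℂ) ((hasLefschetzProperty_lefschetzG hη).sl2Rep isZGrading_countingG (-1)) = 0 := by
  rw [trace_sl2Rep_diagonal hη (-1) (t := -1) (by
    rw [Matrix.SpecialLinearGroup.coe_neg, Matrix.SpecialLinearGroup.coe_one, inv_neg, inv_one]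
    ext i j; fin_cases i <;> fin_cases j <;> simp)]
  exact sum_choose_mul_neg_one_zpow_sub₇₂ (finrank_pos (R := ℂ) (M := E)).ne'

/-- **`tr w² = 0`** (`w² = ρ(−1) = (−1)ʰ`). [cite: Beauville2010SL2, §3 Proposition (ii) ("h² = β(−I)")] [cite: Andre1996Motifs, §1.2 (p. 11)] -/
theorem trace_weylOperator_mul_weylOperator_eq_zero (hη : ∀ v : E, v ≠ 0 → ∃ w : E, η ![v, w] ≠ 0) :
    LinearMap.trace ℂ (GForm E ℂ) ((hasLefschetzProperty_lefschetzG hη).weylOperator isZGrading_countingG *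
      (hasLefschetzProperty_lefschetzG hη).weylOperator isZGrading_countingG) = 0 := by
  rw [← (hasLefschetzProperty_lefschetzG hη).sl2Rep_neg_one isZGrading_countingG, trace_sl2Rep_neg_one_eq_zero hη]

/-- **`tr ρ(1 a ; 0 1) = 4^g = dim H•(X; ℂ)`**: the upper unipotents `exp(a L_η) = e^{aη} ∧ ·` are unipotent ("`X, Y` are nilpotent";
`dim H•(X; ℂ) = 2^{2g}`, tree `finrank_gForm`). [cite: Beauville2010SL2, §4 Theorem ("(1 a ; 0 1)·z = e^{aθ} z … X, Y are nilpotent")]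
[cite: Lange2023AbelianVarietiesComplex, §1.1 Exercise (8)] -/
theorem trace_sl2Rep_upper (hη : ∀ v : E, v ≠ 0 → ∃ w : E, η ![v, w] ≠ 0) (γ : SL(2, ℂ)) {a : ℂ}
    (hγ : (γ : Matrix (Fin 2) (Fin 2) ℂ) = !![1, a; 0, 1]) :
    LinearMap.trace ℂ (GForm E ℂ) ((hasLefschetzProperty_lefschetzG hη).sl2Rep isZGrading_countingG γ) = (4 : ℂ) ^ finrank ℂ E := by
  rw [(hasLefschetzProperty_lefschetzG hη).trace_sl2Rep_of_coe_eq_upper isZGrading_countingG γ hγ, finrank_gForm, pow_mul]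
  norm_num

/-- **`tr ρ(1 0 ; a 1) = 4^g`**: the lower unipotents `exp(a Λ_η)` are unipotent. [cite: Beauville2010SL2, §4 Theorem ("(1 0 ; a 1)·z = d⁻¹ a^g e^{θ/a} ∗ z … X, Y are nilpotent")]
[cite: Lange2023AbelianVarietiesComplex, §1.1 Exercise (8)] -/
theorem trace_sl2Rep_lower (hη : ∀ v : E, v ≠ 0 → ∃ w : E, η ![v, w] ≠ 0) (γ : SL(2, ℂ)) {a : ℂ}
    (hγ : (γ : Matrix (Fin 2) (Fin 2) ℂ) = !![1, 0; a, 1]) :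
    LinearMap.trace ℂ (GForm E ℂ) ((hasLefschetzProperty_lefschetzG hη).sl2Rep isZGrading_countingG γ) = (4 : ℂ) ^ finrank ℂ E := by
  rw [(hasLefschetzProperty_lefschetzG hη).trace_sl2Rep_of_coe_eq_lower isZGrading_countingG γ hγ, finrank_gForm, pow_mul]
  norm_num

/-- `tr ρ(1) = 4^g` (the degree of the representation; consistent with `t^{−g}(1 + t)^{2g}` at `t = 1`). [cite: Lange2023AbelianVarietiesComplex, §1.1 Exercise (8)]
[cite: FultonHarris1991, §23.2 (23.40)] -/
theorem trace_sl2Rep_one (hη : ∀ v : E, v ≠ 0 → ∃ w : E, η ![v, w] ≠ 0) :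
    LinearMap.trace ℂ (GForm E ℂ) ((hasLefschetzProperty_lefschetzG hη).sl2Rep isZGrading_countingG 1) = (4 : ℂ) ^ finrank ℂ E := by
  rw [map_one, LinearMap.trace_one, finrank_gForm, pow_mul]
  norm_num

omit [FiniteDimensional ℂ E] [Nontrivial E] in
/-- Consistency: `Σ_{k=0}^{2g} C(2g, k) = 4^g` (the character at `t = 1`). [cite: Lange2023AbelianVarietiesComplex, §1.1 Exercise (8)] -/
theorem sum_choose_two_mul_eq_four_pow (g : ℕ) : ∑ k ∈ range (2 * g + 1), (2 * g).choose k = 4 ^ g := by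
  rw [Nat.sum_range_choose, pow_mul]
  norm_num

end Character

/-! ## §3 The Lefschetz decomposition in dimensions: `C(2g, k) = Σ_{r ≤ k/2} dim P^{k−2r}(η)` -/

section Decomposition

/-- **`C(2g, k) = Σ_{r=0}^{⌊k/2⌋} dim_ℂ P^{k−2r}(η)` for `k ≤ g`** and EVERY non-degenerate real `2`-form `η`: the Lefschetz decomposition
`Hᵏ = ⊕_r L_ηʳ P^{k−2r}` in dimensions — Beauville's "`CH^p_s(A) = ⊕_{q≤p} θ^{p−q} P^q_s`", here from the abstract multiplicity count
`dim M_{−j} = Σ_i dim P_{−(j+2i)}` (`LefschetzModuleCharacter`) read through §1 (`j = g − k`). (Hodge-number refinement in the tree: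
`IsNSForm.choose_mul_choose_eq_sum_primitiveHodgeNumber`.) [cite: Beauville2010SL2, §5 Corollary (p. 6)] [cite: Lange2023AbelianVarietiesComplex, §7.3.2 (1), (3) (p. 338)]
[cite: LooijengaLunts1997, §1 (1.15)] -/
theorem choose_eq_sum_finrank_primitiveForms (hη : ∀ v : E, v ≠ 0 → ∃ w : E, η ![v, w] ≠ 0) {k : ℕ} (hk : k ≤ finrank ℂ E) :
    (2 * finrank ℂ E).choose k = ∑ r ∈ range (k / 2 + 1), finrank ℂ ↥(primitiveForms η (k - 2 * r)) := by
  -- `dim M_{−(g−k)} = Σ_{i < N} dim P_{−(g−k+2i)}` for `N` large, and the terms with `g − k + 2i > g` vanish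
  have key := finrank_degreeSpace_neg_eq_sum_finrank_primitiveSpace (h := countingG E) (hasLefschetzProperty_lefschetzG hη)
    (finrank ℂ E - k) (k / 2 + 1 + finrank ℂ (GForm E ℂ)) (by omega)
  rw [show (-((finrank ℂ E - k : ℕ) : ℤ)) = (k : ℤ) - (finrank ℂ E : ℤ) by omega, finrank_degreeSpace_countingG, sum_range_add,
    sum_eq_zero (s := range (finrank ℂ (GForm E ℂ))) (fun i _ ↦ finrank_primitiveSpace_countingG_of_lt (by omega)), add_zero] at key
  rw [key]
  refine sum_congr rfl fun r hr ↦ ?_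
  have hr' := mem_range.1 hr
  rw [finrank_primitiveSpace_countingG hη (by omega), show finrank ℂ E - (finrank ℂ E - k + 2 * r) = k - 2 * r by omega]

/-- **`C(2g, g) = Σ_{r=0}^{⌊g/2⌋} dim P^{g−2r}(η)`**: the middle cohomology (`dim M₀`; every string meets it iff its length is odd).
[cite: Beauville2010SL2, §5 Corollary (p. 6)] [cite: Lange2023AbelianVarietiesComplex, §7.3.2 (1) (p. 338)] -/
theorem choose_middle_eq_sum_finrank_primitiveForms (hη : ∀ v : E, v ≠ 0 → ∃ w : E, η ![v, w] ≠ 0) :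
    (2 * finrank ℂ E).choose (finrank ℂ E) = ∑ r ∈ range (finrank ℂ E / 2 + 1), finrank ℂ ↥(primitiveForms η (finrank ℂ E - 2 * r)) :=
  choose_eq_sum_finrank_primitiveForms hη le_rfl

end Decomposition

end ComplexTorus

end Literature.Geometry.Kaehler

end
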